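import Mathlib
import Summits.ResolutionOfSingularities.ResolutionOfSingularities.Theorems.RadicialJungCleanModelsContactChainBestApprox
import HarnessLib

/-!
# Route `RadicialJung`, crux `CleanModels` (stmt-ResolutionOfSingularities-15917), line `Sketch` rev 35, stub 6 `stub_cleanProp44` (X44c),
# work plan O8 / L7b — CAPSTONE: from `CleanRegAt` to a clean-permissible landing, unless the curve's local ring has defect or the line is
# residually a `p`-th power along the curve

Memo `Cruxes/CleanModels/Lines/Sketch-memo-hand2-g8-stubs-5-7.md` §2.  Composition of ✓ `exists_pointChain_cleanPermissibleAt_or_uncharged_of_cleanRegAt`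
(p812661) with ✓ `exists_pointChain_cleanPermissibleAt_of_isDefectlessField` (p813508):

* `exists_pointChain_cleanPermissibleAt_or_pthPower_of_cleanRegAt` — `X₀` regular integral locally Noetherian (universe `0`), `char K(X₀) = p`,
  `C₀` a regular curve through the closed point `x₀` (`dim 𝒪_{X₀,x₀} = 3`), `w` transversal, the valued field `(Frac 𝒪_{C₀,x₀}, 𝒪_{C₀,x₀})`
  DEFECTLESS, and `CleanRegAt p (toFunctionField x₀) G`.  Then EITHER a dominant chain of point blowing ups following `C₀` ends at a point where
  the line of `σ^♯ G` is clean-permissible for the strict transform, OR the line has an all-transversal representative `u · ∏ s_i^{a_i}`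
  (`s_i = γ_i w^{k_i} + π_i`, `p ∣ Σ k_i a_i`) whose unit part `u ∏ γ_i^{a_i}` is a `p`-th power MODULO `𝓘_{C₀,x₀}` — the entry point of the memo's
  (T2) (then the shifted representative vanishes on the curve: (T2a) ✓ p812527 if simple, (T2b) open).

Honest framing: OURS; nothing here proves resolution in characteristic `p`, X44c, or any case of `CleanModels`.
-/

noncomputable section

set_option linter.dupNamespace false -- mandated namespace of this single-conjunct summit

open CategoryTheory AlgebraicGeometry TopologicalSpace IsLocalRing
open Literature.AlgebraicGeometry.Resolution Literature.AlgebraicGeometry.Motives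
open Scheme.IdealSheafData

namespace Summit.ResolutionOfSingularities.ResolutionOfSingularities.Theorems.RadicialJung.CleanModels

/-- **L7b capstone.**  See the module docstring. [cite: CossartJannsenSaito2020, proof of Thm. 6.28, Step 5] [cite: Kuhlmann2010, Section 1 (p. 3)]
[cite: Piltant2013, §2 Axiom 4] -/
theorem exists_pointChain_cleanPermissibleAt_or_pthPower_of_cleanRegAt {X₀ : Scheme.{0}} [IsIntegral X₀] [IsLocallyNoetherian X₀]
    (hX₀ : Scheme.IsRegular X₀) (p : ℕ) [Fact p.Prime] [CharP X₀.functionField p] {C₀ : Closeds X₀}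
    (hC₀reg : ∀ y ∈ (C₀ : Set X₀), ∃ c : Fin 2 → X₀.presheaf.stalk y,
      IsRsopPart c ∧ Ideal.span (Set.range c) = stalkIdeal (vanishingIdeal C₀) y)
    {x₀ : X₀} (hx₀ : IsClosed ({x₀} : Set X₀)) (hx₀C : x₀ ∈ (C₀ : Set X₀)) (hdim₀ : ringKrullDim (X₀.presheaf.stalk x₀) = 3)
    [hP : (stalkIdeal (vanishingIdeal C₀) x₀).IsPrime]
    (w : X₀.presheaf.stalk x₀) (hw : stalkIdeal (vanishingIdeal C₀) x₀ ⊔ Ideal.span {w} = maximalIdeal _)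
    (hdef : ∀ W : ValuationSubring (FractionRing (X₀.presheaf.stalk x₀ ⧸ stalkIdeal (vanishingIdeal C₀) x₀)),
      (∀ x, x ∈ W ↔ ∃ d : X₀.presheaf.stalk x₀ ⧸ stalkIdeal (vanishingIdeal C₀) x₀,
        algebraMap _ (FractionRing (X₀.presheaf.stalk x₀ ⧸ stalkIdeal (vanishingIdeal C₀) x₀)) d = x) →
      IsDefectlessField (FractionRing (X₀.presheaf.stalk x₀ ⧸ stalkIdeal (vanishingIdeal C₀) x₀)) W)
    (G : X₀.functionField) (hG : CleanRegAt p (RatFn.toFunctionField x₀) G) :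
    (∃ (X : Scheme.{0}) (_ : IsIntegral X) (_ : IsLocallyNoetherian X) (σ : X ⟶ X₀) (_ : IsDominant σ) (C : Closeds X) (x : X)
        (n : ℕ), IsPointChainAlong σ C₀ C x n ∧ σ x = x₀ ∧ IsClosed ({x} : Set X) ∧
        CleanPermissibleAt p (RatFn.toFunctionField x) (RatFn.functionFieldMap σ G) (stalkIdeal (vanishingIdeal C) x)) ∨
      ∃ (cc : Fin p → X₀.functionField) (m : ℕ) (s : Fin m → X₀.presheaf.stalk x₀) (a : Fin m → ℕ) (u : X₀.presheaf.stalk x₀)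
        (γ π : Fin m → X₀.presheaf.stalk x₀) (k : Fin m → ℕ) (c : X₀.presheaf.stalk x₀),
        (∃ j : Fin p, (j : ℕ) ≠ 0 ∧ cc j ≠ 0) ∧ IsRsopPart s ∧ (∀ i, ¬ p ∣ a i) ∧ IsUnit u ∧
        (∑ j : Fin p, cc j ^ p * G ^ (j : ℕ)) = RatFn.toFunctionField x₀ (u * ∏ i, s i ^ a i) ∧
        (∀ i, s i ∉ stalkIdeal (vanishingIdeal C₀) x₀) ∧ (∀ i, IsUnit (γ i)) ∧
        (∀ i, π i ∈ stalkIdeal (vanishingIdeal C₀) x₀) ∧ (∀ i, s i = γ i * w ^ k i + π i) ∧ p ∣ ∑ i, k i * a i ∧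
        u * ∏ i, γ i ^ a i - c ^ p ∈ stalkIdeal (vanishingIdeal C₀) x₀ := by
  classical
  rcases exists_pointChain_cleanPermissibleAt_or_uncharged_of_cleanRegAt hX₀ p hC₀reg hx₀ hx₀C hdim₀ w hw G hG with
    hexit | ⟨cc, m, s, a, u, γ, π, k, hcc, hs, ha, hu, hX, hsP, hγ, hπ, hsk, hdiv⟩
  · exact Or.inl hexit
  by_cases hv : ∀ c : X₀.presheaf.stalk x₀, u * ∏ i, γ i ^ a i - c ^ p ∉ stalkIdeal (vanishingIdeal C₀) x₀
  · -- `v̄ ∉ D^p`: exit from a good approximation (defectlessness)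
    left
    obtain ⟨N', hN'⟩ := hdiv
    have hX' : (∑ j : Fin p, cc j ^ p * G ^ (j : ℕ)) = RatFn.toFunctionField x₀ (u * ∏ i, (γ i * w ^ k i + π i) ^ a i) := by
      rw [hX]
      congr 1
      exact congrArg (u * ·) (Finset.prod_congr rfl fun i _ => by rw [hsk i])
    exact exists_pointChain_cleanPermissibleAt_of_isDefectlessField hX₀ p hC₀reg hx₀ hx₀C hdim₀ G cc hcc w u hw hu γ π hγ hπ k a
      (N' := N') (by rw [hN', mul_comm]) hX' hv hdef
  · push Not at hv
    obtain ⟨c, hc⟩ := hv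
    exact Or.inr ⟨cc, m, s, a, u, γ, π, k, c, hcc, hs, ha, hu, hX, hsP, hγ, hπ, hsk, hdiv, hc⟩

end Summit.ResolutionOfSingularities.ResolutionOfSingularities.Theorems.RadicialJung.CleanModels

end
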